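/-
Copyright (c) 2026 the pub-hodgecm-mathlib formalisation cell (harness21).  Prover seat hodgecm-mathlib-F0P2-p02 (g10): road «S3-tree» (LEAD F0P3a-plan (g11) WORD T10-2;
architect A-p16 (g29) A-63 (1)), brick T2-S, FILE 4c = THE TORUS ACTION ON THE APARTMENT, VERTEX FORM; 2026-09-01.
-/
import Literature.NumberTheory.Automorphic.UnitaryLatticeTreeApartmentTorus   -- ★ T2-S FILE 4a (F0P2-p02 (g10)) p845484: `mapGL_latt_apartment_*` (pointwise fixing, translation); brings ★ T1 Apartment
import HarnessLib

/-!
# The split torus of `U(3)` on its apartment, in VERTEX form: `latticeGraphIso t` fixes `L_a`, `L′_a` (compact part) and shifts `L_a ↦ L_{a+c}`, `L′_a ↦ L′_{a+c}` (translation) (Bruhat–Tits 1972 §10; Serre, *Trees* I.6.4)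

Topic `NumberTheory/Automorphic`; namespace `Literature.NumberTheory.Automorphic.UnitaryLatticeTree` (T1a's).  THEOREMS ONLY: no definition, no named fact, no instance, no
notation, no `sorry`.  Cell `pub/hodgecm-mathlib` (D-0151), crux H413 = `stmt-HodgeConjecture-24833`; road «S3-tree», brick **T2-S** (holder F0P2-p02 (g10)), FILE 4c: the lattice
identities of ★ FILE 4a (`…ApartmentTorus`) restated on the VERTEX TYPE `{M // IsVertex σ ϖ J₀ M}` of ★ T1a's `latticeGraph`, i.e. for the graph automorphism `latticeGraphIso σ ϖ J₀ t`
— the exact currency of the generic tree-action organs (★ `TreeActionAxis*` F0P2-p02 (g9), ★ `TreeHereditaryLayerCount` F0P3a-p08 (g17): `act τ v₀`, «`γ` fixes the axis pointwise»,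
«`τ` translates it freely»).  HONEST LABEL: HC_CM is proved only modulo the 2 remaining named inputs (hLiu418 24832, h413 24833) until rung 0 closes; nothing printed is asserted.

* `vertexSelfDual ∕ vertexTwo` are NOT definitions: the apartment vertices are written as anonymous-constructor subtype terms with the ★ B-p14 witnesses
  (`isSelfDualLattice_latt_diagonal_zpow`, `isVertexLattice_two_latt_diagonal_zpow`), exactly as in ★ FILE 4b.
* §1 **`latticeGraphIso_apartment_selfDual_of_units` ∕ `…_two_of_units`**: `t ∈ U(σ, J₀)` with matrix `diag(u, s, w)`, `|u| = |s| = |w| = 1` ⇒ `latticeGraphIso t` FIXES the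
  vertices `L_a` and `L′_a` (all `a : ℤ`).
* §2 **`latticeGraphIso_apartment_selfDual_translate` ∕ `…_two_translate`**: `t` with matrix `diag(ϖ^c, 1, ϖ^{−c})` maps the vertex `L_a` to `L_{a+c}` and `L′_a` to `L′_{a+c}`.

## References
* [BruhatTits1972] F. Bruhat, J. Tits, *Groupes réductifs sur un corps local I*, Publ. Math. IHÉS 41 (1972), §10.
* [Serre1980Trees] J.-P. Serre, *Trees* (1980), Ch. I §6.4, Ch. II §1.1.
-/

set_option autoImplicit false

noncomputable section

open scoped Valued WithZero Matrix MatrixGroups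

namespace Literature.NumberTheory.Automorphic.UnitaryLatticeTree

open Literature.NumberTheory.Automorphic Literature.NumberTheory.Automorphic.HermitianLattice
open Literature.NumberTheory.Automorphic.CartanUnique (uniformizer_ne_zero)

variable {K : Type*} [Field K] [Valued K ℤᵐ⁰] {σ : K →+* K} {ϖ : K}

/-- `|ϖ| ≤ 1` for a uniformiser `|ϖ| = exp(−1)`. [cite: Serre1980Trees, II.1.1] -/
theorem v_le_one_of_v_eq_exp_neg_one (hϖ : Valued.v ϖ = WithZero.exp (-1 : ℤ)) : Valued.v ϖ ≤ 1 := by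
  rw [hϖ, ← WithZero.exp_zero, WithZero.exp_le_exp]; norm_num

/-! ## §1 The compact part fixes the apartment vertices -/

/-- **`latticeGraphIso t` fixes the self-dual apartment vertex `L_a`** for `t ∈ U(σ, J₀)` with matrix `diag(u, s, w)`, all entries units. [cite: BruhatTits1972, §10] [cite: Serre1980Trees, I.6.4] -/
theorem latticeGraphIso_apartment_selfDual_of_units (hσ : ∀ x, σ (σ x) = x) (hσϖ : σ ϖ = ϖ) (hϖ : Valued.v ϖ = WithZero.exp (-1 : ℤ))
    (t : unitaryGroupOfForm σ ((StdForm.antidiagonal 3).over K)) (u s w : K)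
    (ht : ((t : GL (Fin 3) K) : Matrix (Fin 3) (Fin 3) K) = Matrix.diagonal ![u, s, w])
    (hu : Valued.v u = 1) (hs : Valued.v s = 1) (hw : Valued.v w = 1) (a : ℤ) :
    latticeGraphIso σ ϖ ((StdForm.antidiagonal 3).over K) t
        ⟨latt (Matrix.diagonal ![ϖ ^ a, (1 : K), ϖ ^ (-a)]),
          ⟨0, isSelfDualLattice_latt_diagonal_zpow hσ hσϖ (v_le_one_of_v_eq_exp_neg_one hϖ) (uniformizer_ne_zero hϖ) a⟩⟩ =
      ⟨latt (Matrix.diagonal ![ϖ ^ a, (1 : K), ϖ ^ (-a)]),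
        ⟨0, isSelfDualLattice_latt_diagonal_zpow hσ hσϖ (v_le_one_of_v_eq_exp_neg_one hϖ) (uniformizer_ne_zero hϖ) a⟩⟩ := by
  apply Subtype.ext
  change mapGL (t : GL (Fin 3) K) (latt (Matrix.diagonal ![ϖ ^ a, (1 : K), ϖ ^ (-a)])) = latt (Matrix.diagonal ![ϖ ^ a, (1 : K), ϖ ^ (-a)])
  exact mapGL_latt_apartment_selfDual_of_units _ u s w ϖ ht hu hs hw (uniformizer_ne_zero hϖ) a

/-- **`latticeGraphIso t` fixes the type-two apartment vertex `L′_a`** for `t` with matrix `diag(u, s, w)`, all entries units. [cite: BruhatTits1972, §10] [cite: Serre1980Trees, I.6.4] -/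
theorem latticeGraphIso_apartment_two_of_units (hσ : ∀ x, σ (σ x) = x) (hσϖ : σ ϖ = ϖ) (hϖ : Valued.v ϖ = WithZero.exp (-1 : ℤ))
    (t : unitaryGroupOfForm σ ((StdForm.antidiagonal 3).over K)) (u s w : K)
    (ht : ((t : GL (Fin 3) K) : Matrix (Fin 3) (Fin 3) K) = Matrix.diagonal ![u, s, w])
    (hu : Valued.v u = 1) (hs : Valued.v s = 1) (hw : Valued.v w = 1) (a : ℤ) :
    latticeGraphIso σ ϖ ((StdForm.antidiagonal 3).over K) t
        ⟨latt (Matrix.diagonal ![ϖ ^ a, (1 : K), ϖ ^ (1 - a)]),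
          ⟨2, isVertexLattice_two_latt_diagonal_zpow hσ hσϖ (v_le_one_of_v_eq_exp_neg_one hϖ) (uniformizer_ne_zero hϖ) a⟩⟩ =
      ⟨latt (Matrix.diagonal ![ϖ ^ a, (1 : K), ϖ ^ (1 - a)]),
        ⟨2, isVertexLattice_two_latt_diagonal_zpow hσ hσϖ (v_le_one_of_v_eq_exp_neg_one hϖ) (uniformizer_ne_zero hϖ) a⟩⟩ := by
  apply Subtype.ext
  change mapGL (t : GL (Fin 3) K) (latt (Matrix.diagonal ![ϖ ^ a, (1 : K), ϖ ^ (1 - a)])) = latt (Matrix.diagonal ![ϖ ^ a, (1 : K), ϖ ^ (1 - a)])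
  exact mapGL_latt_apartment_two_of_units _ u s w ϖ ht hu hs hw (uniformizer_ne_zero hϖ) a

/-! ## §2 The translation shifts the apartment vertices -/

/-- **`latticeGraphIso t_c` maps the vertex `L_a` to `L_{a+c}`** for `t_c` with matrix `diag(ϖ^c, 1, ϖ^{−c})` (★ `exists_coe_eq_diagonal_zpow`). [cite: BruhatTits1972, §10] [cite: Serre1980Trees, I.6.4] -/
theorem latticeGraphIso_apartment_selfDual_translate (hσ : ∀ x, σ (σ x) = x) (hσϖ : σ ϖ = ϖ) (hϖ : Valued.v ϖ = WithZero.exp (-1 : ℤ))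
    (t : unitaryGroupOfForm σ ((StdForm.antidiagonal 3).over K)) (c a : ℤ)
    (ht : ((t : GL (Fin 3) K) : Matrix (Fin 3) (Fin 3) K) = Matrix.diagonal ![ϖ ^ c, 1, ϖ ^ (-c)]) :
    latticeGraphIso σ ϖ ((StdForm.antidiagonal 3).over K) t
        ⟨latt (Matrix.diagonal ![ϖ ^ a, (1 : K), ϖ ^ (-a)]),
          ⟨0, isSelfDualLattice_latt_diagonal_zpow hσ hσϖ (v_le_one_of_v_eq_exp_neg_one hϖ) (uniformizer_ne_zero hϖ) a⟩⟩ =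
      ⟨latt (Matrix.diagonal ![ϖ ^ (a + c), (1 : K), ϖ ^ (-(a + c))]),
        ⟨0, isSelfDualLattice_latt_diagonal_zpow hσ hσϖ (v_le_one_of_v_eq_exp_neg_one hϖ) (uniformizer_ne_zero hϖ) (a + c)⟩⟩ := by
  apply Subtype.ext
  change mapGL (t : GL (Fin 3) K) (latt (Matrix.diagonal ![ϖ ^ a, (1 : K), ϖ ^ (-a)])) = latt (Matrix.diagonal ![ϖ ^ (a + c), (1 : K), ϖ ^ (-(a + c))])
  exact mapGL_latt_apartment_selfDual_translate _ ϖ (uniformizer_ne_zero hϖ) c a ht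

/-- **`latticeGraphIso t_c` maps the vertex `L′_a` to `L′_{a+c}`.** [cite: BruhatTits1972, §10] [cite: Serre1980Trees, I.6.4] -/
theorem latticeGraphIso_apartment_two_translate (hσ : ∀ x, σ (σ x) = x) (hσϖ : σ ϖ = ϖ) (hϖ : Valued.v ϖ = WithZero.exp (-1 : ℤ))
    (t : unitaryGroupOfForm σ ((StdForm.antidiagonal 3).over K)) (c a : ℤ)
    (ht : ((t : GL (Fin 3) K) : Matrix (Fin 3) (Fin 3) K) = Matrix.diagonal ![ϖ ^ c, 1, ϖ ^ (-c)]) :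
    latticeGraphIso σ ϖ ((StdForm.antidiagonal 3).over K) t
        ⟨latt (Matrix.diagonal ![ϖ ^ a, (1 : K), ϖ ^ (1 - a)]),
          ⟨2, isVertexLattice_two_latt_diagonal_zpow hσ hσϖ (v_le_one_of_v_eq_exp_neg_one hϖ) (uniformizer_ne_zero hϖ) a⟩⟩ =
      ⟨latt (Matrix.diagonal ![ϖ ^ (a + c), (1 : K), ϖ ^ (1 - (a + c))]),
        ⟨2, isVertexLattice_two_latt_diagonal_zpow hσ hσϖ (v_le_one_of_v_eq_exp_neg_one hϖ) (uniformizer_ne_zero hϖ) (a + c)⟩⟩ := by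
  apply Subtype.ext
  change mapGL (t : GL (Fin 3) K) (latt (Matrix.diagonal ![ϖ ^ a, (1 : K), ϖ ^ (1 - a)])) = latt (Matrix.diagonal ![ϖ ^ (a + c), (1 : K), ϖ ^ (1 - (a + c))])
  exact mapGL_latt_apartment_two_translate _ ϖ (uniformizer_ne_zero hϖ) c a ht

/-- **The translation is FREE on the self-dual apartment vertices, vertex form**: `latticeGraphIso t_c` fixes the vertex `L_a` only if `c = 0`. [cite: Serre1980Trees, I.6.4] -/
theorem eq_zero_of_latticeGraphIso_apartment_selfDual_eq (hσ : ∀ x, σ (σ x) = x) (hσϖ : σ ϖ = ϖ) (hϖ : Valued.v ϖ = WithZero.exp (-1 : ℤ))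
    (t : unitaryGroupOfForm σ ((StdForm.antidiagonal 3).over K)) (c a : ℤ)
    (ht : ((t : GL (Fin 3) K) : Matrix (Fin 3) (Fin 3) K) = Matrix.diagonal ![ϖ ^ c, 1, ϖ ^ (-c)])
    (hfix : latticeGraphIso σ ϖ ((StdForm.antidiagonal 3).over K) t
        ⟨latt (Matrix.diagonal ![ϖ ^ a, (1 : K), ϖ ^ (-a)]),
          ⟨0, isSelfDualLattice_latt_diagonal_zpow hσ hσϖ (v_le_one_of_v_eq_exp_neg_one hϖ) (uniformizer_ne_zero hϖ) a⟩⟩ =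
      ⟨latt (Matrix.diagonal ![ϖ ^ a, (1 : K), ϖ ^ (-a)]),
        ⟨0, isSelfDualLattice_latt_diagonal_zpow hσ hσϖ (v_le_one_of_v_eq_exp_neg_one hϖ) (uniformizer_ne_zero hϖ) a⟩⟩) : c = 0 := by
  have h := congrArg Subtype.val hfix
  exact eq_zero_of_mapGL_latt_apartment_selfDual_eq (t : GL (Fin 3) K) ϖ hϖ c a ht h

/-! ## §3 (ED. 2) The translation for ANY valuation-preserving `σ` — the unitary torus element `diag(ϖ^c, 1, (σϖ)^{−c})`, no `σϖ = ϖ`: the tame-ramified reading -/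

/-- **Lattice level: `diag(ϖ^c, 1, (σϖ)^{−c}) · L_a = L_{a+c}`** for `σ` valuation-preserving (`|σϖ| = |ϖ|`: diagonal lattices only see valuations, ★ `latt_diagonal_congr`).  At an
unramified place `σϖ = ϖ` and this is ★ `mapGL_latt_apartment_selfDual_translate`; at a tamely ramified place `σϖ = −ϖ` and the unitary translation is `diag(ϖ^c, 1, (−ϖ)^{−c})`
(★ `exists_coe_eq_diagonal_zpow_of_involution`). [cite: BruhatTits1972, §10] [cite: Serre1980Trees, I.6.4] -/
theorem mapGL_latt_apartment_selfDual_translate_of_v (hvσ : ∀ x, Valued.v (σ x) = Valued.v x) (hϖ0 : ϖ ≠ 0) (t : GL (Fin 3) K) (c a : ℤ)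
    (ht : (t : Matrix (Fin 3) (Fin 3) K) = Matrix.diagonal ![ϖ ^ c, 1, (σ ϖ) ^ (-c)]) :
    mapGL t (latt (Matrix.diagonal ![ϖ ^ a, (1 : K), ϖ ^ (-a)])) = latt (Matrix.diagonal ![ϖ ^ (a + c), (1 : K), ϖ ^ (-(a + c))]) := by
  have hσϖ0 : σ ϖ ≠ 0 := (map_ne_zero σ).2 hϖ0
  rw [mapGL, ← latt_mul, ht, diagonal_three_mul, one_mul]
  refine latt_diagonal_congr (fun i => ?_) (fun i => ?_)
  · fin_cases i
    · exact mul_ne_zero (zpow_ne_zero c hϖ0) (zpow_ne_zero a hϖ0)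
    · exact one_ne_zero
    · exact mul_ne_zero (zpow_ne_zero (-c) hσϖ0) (zpow_ne_zero (-a) hϖ0)
  · fin_cases i
    · change Valued.v (ϖ ^ c * ϖ ^ a) = Valued.v (ϖ ^ (a + c))
      rw [← zpow_add₀ hϖ0, add_comm]
    · rfl
    · change Valued.v ((σ ϖ) ^ (-c) * ϖ ^ (-a)) = Valued.v (ϖ ^ (-(a + c)))
      rw [map_mul, map_zpow₀, hvσ, ← map_zpow₀, ← map_mul, ← zpow_add₀ hϖ0, neg_add, add_comm]

/-- **Lattice level: `diag(ϖ^c, 1, (σϖ)^{−c}) · L′_a = L′_{a+c}`.** [cite: BruhatTits1972, §10] [cite: Serre1980Trees, I.6.4] -/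
theorem mapGL_latt_apartment_two_translate_of_v (hvσ : ∀ x, Valued.v (σ x) = Valued.v x) (hϖ0 : ϖ ≠ 0) (t : GL (Fin 3) K) (c a : ℤ)
    (ht : (t : Matrix (Fin 3) (Fin 3) K) = Matrix.diagonal ![ϖ ^ c, 1, (σ ϖ) ^ (-c)]) :
    mapGL t (latt (Matrix.diagonal ![ϖ ^ a, (1 : K), ϖ ^ (1 - a)])) = latt (Matrix.diagonal ![ϖ ^ (a + c), (1 : K), ϖ ^ (1 - (a + c))]) := by
  have hσϖ0 : σ ϖ ≠ 0 := (map_ne_zero σ).2 hϖ0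
  rw [mapGL, ← latt_mul, ht, diagonal_three_mul, one_mul]
  refine latt_diagonal_congr (fun i => ?_) (fun i => ?_)
  · fin_cases i
    · exact mul_ne_zero (zpow_ne_zero c hϖ0) (zpow_ne_zero a hϖ0)
    · exact one_ne_zero
    · exact mul_ne_zero (zpow_ne_zero (-c) hσϖ0) (zpow_ne_zero (1 - a) hϖ0)
  · fin_cases i
    · change Valued.v (ϖ ^ c * ϖ ^ a) = Valued.v (ϖ ^ (a + c))
      rw [← zpow_add₀ hϖ0, add_comm]
    · rfl
    · change Valued.v ((σ ϖ) ^ (-c) * ϖ ^ (1 - a)) = Valued.v (ϖ ^ (1 - (a + c)))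
      rw [map_mul, map_zpow₀, hvσ, ← map_zpow₀, ← map_mul, ← zpow_add₀ hϖ0]
      congr 2
      ring

/-- **Vertex form: `latticeGraphIso t` maps `L_a` to `L_{a+c}`** for `t ∈ U(σ, J₀)` with matrix `diag(ϖ^c, 1, (σϖ)^{−c})`, for ANY vertex witnesses `p`, `q` (unramified: the ★ §2
witnesses; tamely ramified: ★ `isSelfDualLattice_latt_diagonal_zpow_of_v`).  No `σϖ = ϖ`. [cite: BruhatTits1972, §10] [cite: Serre1980Trees, I.6.4] -/
theorem latticeGraphIso_apartment_selfDual_translate_of_isVertex (hvσ : ∀ x, Valued.v (σ x) = Valued.v x) (hϖ0 : ϖ ≠ 0)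
    (t : unitaryGroupOfForm σ ((StdForm.antidiagonal 3).over K)) (c a : ℤ)
    (ht : ((t : GL (Fin 3) K) : Matrix (Fin 3) (Fin 3) K) = Matrix.diagonal ![ϖ ^ c, 1, (σ ϖ) ^ (-c)])
    (p : IsVertex σ ϖ ((StdForm.antidiagonal 3).over K) (latt (Matrix.diagonal ![ϖ ^ a, (1 : K), ϖ ^ (-a)])))
    (q : IsVertex σ ϖ ((StdForm.antidiagonal 3).over K) (latt (Matrix.diagonal ![ϖ ^ (a + c), (1 : K), ϖ ^ (-(a + c))]))) :
    latticeGraphIso σ ϖ ((StdForm.antidiagonal 3).over K) t ⟨latt (Matrix.diagonal ![ϖ ^ a, (1 : K), ϖ ^ (-a)]), p⟩ =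
      ⟨latt (Matrix.diagonal ![ϖ ^ (a + c), (1 : K), ϖ ^ (-(a + c))]), q⟩ := by
  apply Subtype.ext
  change mapGL (t : GL (Fin 3) K) (latt (Matrix.diagonal ![ϖ ^ a, (1 : K), ϖ ^ (-a)])) = latt (Matrix.diagonal ![ϖ ^ (a + c), (1 : K), ϖ ^ (-(a + c))])
  exact mapGL_latt_apartment_selfDual_translate_of_v hvσ hϖ0 _ c a ht

/-- **Vertex form: `latticeGraphIso t` maps `L′_a` to `L′_{a+c}`** (same generality). [cite: BruhatTits1972, §10] [cite: Serre1980Trees, I.6.4] -/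
theorem latticeGraphIso_apartment_two_translate_of_isVertex (hvσ : ∀ x, Valued.v (σ x) = Valued.v x) (hϖ0 : ϖ ≠ 0)
    (t : unitaryGroupOfForm σ ((StdForm.antidiagonal 3).over K)) (c a : ℤ)
    (ht : ((t : GL (Fin 3) K) : Matrix (Fin 3) (Fin 3) K) = Matrix.diagonal ![ϖ ^ c, 1, (σ ϖ) ^ (-c)])
    (p : IsVertex σ ϖ ((StdForm.antidiagonal 3).over K) (latt (Matrix.diagonal ![ϖ ^ a, (1 : K), ϖ ^ (1 - a)])))
    (q : IsVertex σ ϖ ((StdForm.antidiagonal 3).over K) (latt (Matrix.diagonal ![ϖ ^ (a + c), (1 : K), ϖ ^ (1 - (a + c))]))) :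
    latticeGraphIso σ ϖ ((StdForm.antidiagonal 3).over K) t ⟨latt (Matrix.diagonal ![ϖ ^ a, (1 : K), ϖ ^ (1 - a)]), p⟩ =
      ⟨latt (Matrix.diagonal ![ϖ ^ (a + c), (1 : K), ϖ ^ (1 - (a + c))]), q⟩ := by
  apply Subtype.ext
  change mapGL (t : GL (Fin 3) K) (latt (Matrix.diagonal ![ϖ ^ a, (1 : K), ϖ ^ (1 - a)])) = latt (Matrix.diagonal ![ϖ ^ (a + c), (1 : K), ϖ ^ (1 - (a + c))])
  exact mapGL_latt_apartment_two_translate_of_v hvσ hϖ0 _ c a ht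

/-- **Vertex form: a unit-diagonal `t` fixes `L_a` and `L′_a`, for ANY vertex witnesses** (the compact part of the torus at any place; ★ §1 with the witnesses freed).
[cite: BruhatTits1972, §10] [cite: Serre1980Trees, I.6.4] -/
theorem latticeGraphIso_apartment_of_units_of_isVertex (hϖ0 : ϖ ≠ 0) (t : unitaryGroupOfForm σ ((StdForm.antidiagonal 3).over K)) (u s w : K)
    (ht : ((t : GL (Fin 3) K) : Matrix (Fin 3) (Fin 3) K) = Matrix.diagonal ![u, s, w]) (hu : Valued.v u = 1) (hs : Valued.v s = 1)
    (hw : Valued.v w = 1) (a : ℤ)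
    (p : IsVertex σ ϖ ((StdForm.antidiagonal 3).over K) (latt (Matrix.diagonal ![ϖ ^ a, (1 : K), ϖ ^ (-a)])))
    (p' : IsVertex σ ϖ ((StdForm.antidiagonal 3).over K) (latt (Matrix.diagonal ![ϖ ^ a, (1 : K), ϖ ^ (1 - a)]))) :
    latticeGraphIso σ ϖ ((StdForm.antidiagonal 3).over K) t ⟨latt (Matrix.diagonal ![ϖ ^ a, (1 : K), ϖ ^ (-a)]), p⟩ =
        ⟨latt (Matrix.diagonal ![ϖ ^ a, (1 : K), ϖ ^ (-a)]), p⟩ ∧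
      latticeGraphIso σ ϖ ((StdForm.antidiagonal 3).over K) t ⟨latt (Matrix.diagonal ![ϖ ^ a, (1 : K), ϖ ^ (1 - a)]), p'⟩ =
        ⟨latt (Matrix.diagonal ![ϖ ^ a, (1 : K), ϖ ^ (1 - a)]), p'⟩ := by
  constructor
  · apply Subtype.ext
    change mapGL (t : GL (Fin 3) K) (latt (Matrix.diagonal ![ϖ ^ a, (1 : K), ϖ ^ (-a)])) = latt (Matrix.diagonal ![ϖ ^ a, (1 : K), ϖ ^ (-a)])
    exact mapGL_latt_apartment_selfDual_of_units _ u s w ϖ ht hu hs hw hϖ0 a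
  · apply Subtype.ext
    change mapGL (t : GL (Fin 3) K) (latt (Matrix.diagonal ![ϖ ^ a, (1 : K), ϖ ^ (1 - a)])) = latt (Matrix.diagonal ![ϖ ^ a, (1 : K), ϖ ^ (1 - a)])
    exact mapGL_latt_apartment_two_of_units _ u s w ϖ ht hu hs hw hϖ0 a

end Literature.NumberTheory.Automorphic.UnitaryLatticeTree

end
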